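import Summits.CriticalPhenomena.PercolationContinuityZ3.Theorems.PercNearOneGluingNoHeavyConstsClusterSquareTwoCopy
import Summits.CriticalPhenomena.PercolationContinuityZ3.Theorems.PercNearOneGluingNoHeavyConstsClosedWitnessBK
import HarnessLib

/-!
# The cluster-square inequality when no double clash occurs (two-copy decision-tree BK)

builds on p205010 (kernel theorem, internal audit signed; external expert review pending)

PAPER-2 track "percolation constants", part (ii), seat `prim-consts-1`, gen 17 (lane index
`run/shared/lean/prim/consts/CONSTANTS.md`, row A19; memo `FROM-prim-consts-1-g17-THREE-COPY-STRUCTURE.md` §0(6)).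
Support file for the crux `NoHeavyLowerTail` (stmt-CriticalPhenomena-4575; `--supports`).  Theorems only; no sorries.

Notation (finite weighted graph, `μ = prodBernoulli w`, vertices `a, b, c`): `X = a|b|c`, `D_a = {a ↮ b, a ↮ c}`, `U = μ(b ↮ c)`,
`K = C_a(ω)` the open cluster of `a`, `u(ω) = μ{b ↮ c off C_a(ω)}` (`Consts.sepOffCluster`), `T = ∫_{D_a} u² dμ`
(`Consts.clusterSquare`); the CONJECTURE CSQ (`Consts.ClusterSquareSplit`, gen 15) is `T ≤ U²` and implies the rooted split
inequality DUU and the triple-split inequality TS.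

THE TWO-COPY FORM.  `T = P(C₁ ∈ X, C₁ →_S C₂ ∈ X)` where `S = S(C₁)` is the set of pairs revealed by the exploration of `C_a(C₁)`
(`Consts.setIntegral_sepOff_sq_eq_Pr2W`).  A pair `(C₁, C₃ = C₁ →_S C₂)` of this event has closed cuts `∂C_b(C₁)`, `∂C_c(C₁)` in `C₁` and
`∂C_b(C₃)`, `∂C_c(C₃)` in `C₃` (boundaries through pairs of positive weight); the witness pairs (`∂C_b(C₁)`, `∂C_c(C₃)`) and
(`∂C_c(C₁)`, `∂C_b(C₃)`) are disjoint on `S` unless, respectively, some `y ∈ C_b(C₁) ∩ C_c(C₃)` or some `y' ∈ C_c(C₁) ∩ C_b(C₃)` is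
joined to `K` by a pair of positive weight.  **No double clash** (the hypothesis of the theorems below, stated in terms of `ω = C₁` and a
fresh configuration `η` off the pairs meeting `C_a(ω)`, which is what `C₃` is there) = never both.  Then the closed-witness form of
Gladkov's decision-tree van den Berg–Kesten inequality (`Consts.ClosedBK.Pr2W_closedWitness_le`) gives `T ≤ U²`:

* `Consts.setIntegral_sepOff_sq_le_sq_add_doubleClash` — for EVERY finite weighted graph, `T ≤ μ(b↮c)² + P(E ∩ {double clash})`
  (the pairs of the two-copy event `E` without a double clash have probability at most `μ(b↮c)²`);
* **`Consts.clusterSquare_le_sq_of_noDoubleClash`** — CSQ at `(a; b, c)` under the no-double-clash hypothesis;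
* `Consts.sq_real_split_le_of_noDoubleClash` (DUU at the root `a`) and `Consts.tripleSplit_of_noDoubleClash` (TS for the triple);
* `Consts.noDoubleClash_of_card_le_four` (a double clash needs five vertices), hence UNCONDITIONALLY on `≤ 4` vertices:
  `Consts.clusterSquare_le_sq_of_le_four` (CSQ) and `Consts.tripleSplit_of_le_four` (TS, e.g. every weighted `K₄`).

The hypothesis holds, e.g., for `K₄`, cycles, `K₂,₃` rooted in the 2-part, the wheel `W₄` with `a, b, c` on the rim, and (by a
Jordan-curve argument at the contracted cluster, not formalised here) for every planar graph with `a, b, c` on a common face — the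
disconnection analogue of Gladkov's planar three-point bound (his Thm 6.1) with constant `1`; it fails for `W₄` with `a` at the hub,
`K₅`, and the graph `G₇` of the gen-15 memo (seat engine `ndc.py`).
References: N. Gladkov, arXiv:2408.08457v2 (2024), Def. 4.2, Thm. 4.3, Lemma 3.1, Example 2.5, Thm. 5.2, Thm. 6.1;
J. van den Berg, O. Häggström, J. Kahn, Random Structures Algorithms 29 (2006), §1 p. 8.
-/

noncomputable section

open Classical

namespace Summit.CriticalPhenomena.PercolationContinuityZ3.Theorems

open MeasureTheory Finset Literature.Probability.LatticeModels Literature.Probability.Percolation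
open Literature.Probability.Percolation.DecisionTree Literature.Probability.Percolation.BHK2006
open Literature.Probability.Percolation.TargetExploration Literature.Probability.Percolation.ClusterConditioning

namespace Consts

section General

variable {V : Type*} [Fintype V]

/-! ### The cluster-square inequality up to the double-clash pairs, and under "no double clash" -/

/-- **`T ≤ U² + P(double-clash pairs)` (every finite weighted graph).**  With `E = {(C₁, C₂) : C₁ ∈ X, C₁ →_S C₂ ∈ X}` (so
`T = P(E)`), the pairs of `E` WITHOUT a double clash (not both: some `y ∈ C_b(C₁) ∩ C_c(C₁ →_S C₂)` and some
`y' ∈ C_c(C₁) ∩ C_b(C₁ →_S C₂)` joined to `C_a(C₁)` by pairs of positive weight) have probability at most `μ(b ↮ c)²` by the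
closed-witness decision-tree vdBK inequality; hence `∫_{D_a} u² dμ ≤ μ(b↮c)² + P(E ∩ {double clash})`.
[cite: Gladkov2024, Thm. 4.3 with Def. 4.2, Lemma 3.1, Example 2.5] -/
theorem setIntegral_sepOff_sq_le_sq_add_doubleClash (w : Sym2 V → unitInterval) (a b c : V) :
    (∫ ω in (openConn a b)ᶜ ∩ (openConn a c)ᶜ,
        (prodBernoulli w).real {η | ¬ (openGraph (η \ barOf {a} (setCl ω {a}))).Reachable b c} ^ 2 ∂(prodBernoulli w)) ≤
      (prodBernoulli w).real (openConn b c)ᶜ ^ 2 +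
        Pr2W Finset.univ (fun e => (w e : ℝ))
          ({x : Finset (Sym2 V) × Finset (Sym2 V) |
              (↑x.1 : Set (Sym2 V)) ∈ (openConn a b)ᶜ ∩ (openConn a c)ᶜ ∩ (openConn b c)ᶜ ∧
              (↑(splice (revealedAt (Finset.univ : Finset (Sym2 V)) (∅ : Finset V) a x.1) x.1 x.2) : Set (Sym2 V)) ∈
                (openConn a b)ᶜ ∩ (openConn a c)ᶜ ∩ (openConn b c)ᶜ} ∩
            {x | (∃ y k : V, (openGraph (↑x.1 : Set (Sym2 V))).Reachable a k ∧ (0 : ℝ) < w s(k, y) ∧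
                  (openGraph (↑x.1 : Set (Sym2 V))).Reachable b y ∧
                  (openGraph (↑(splice (revealedAt (Finset.univ : Finset (Sym2 V)) (∅ : Finset V) a x.1) x.1 x.2) :
                    Set (Sym2 V))).Reachable c y) ∧
                (∃ y k : V, (openGraph (↑x.1 : Set (Sym2 V))).Reachable a k ∧ (0 : ℝ) < w s(k, y) ∧
                  (openGraph (↑x.1 : Set (Sym2 V))).Reachable c y ∧
                  (openGraph (↑(splice (revealedAt (Finset.univ : Finset (Sym2 V)) (∅ : Finset V) a x.1) x.1 x.2) :
                    Set (Sym2 V))).Reachable b y)}) := by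
  set p : Sym2 V → ℝ := fun e => (w e : ℝ) with hp
  have hp0 : ∀ e, 0 ≤ p e := fun e => (w e).2.1
  have hp1 : ∀ e, p e ≤ 1 := fun e => (w e).2.2
  set P : Finset (Sym2 V) := Finset.univ.filter fun e => (0 : ℝ) < w e with hPdef
  have hP : ∀ e, e ∈ P ↔ (0 : ℝ) < w e := fun e => by simp [hPdef]
  set Xs : Set (Set (Sym2 V)) := (openConn a b)ᶜ ∩ (openConn a c)ᶜ ∩ (openConn b c)ᶜ with hXs
  set A : Set (Finset (Sym2 V)) := {C | ¬ (openGraph (↑(C ∩ P) : Set (Sym2 V))).Reachable b c} with hA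
  set E : Set (Finset (Sym2 V) × Finset (Sym2 V)) := {x | (↑x.1 : Set (Sym2 V)) ∈ Xs ∧
    (↑(splice (revealedAt (Finset.univ : Finset (Sym2 V)) (∅ : Finset V) a x.1) x.1 x.2) : Set (Sym2 V)) ∈ Xs} with hE
  set Bad : Set (Finset (Sym2 V) × Finset (Sym2 V)) := {x |
    (∃ y k : V, (openGraph (↑x.1 : Set (Sym2 V))).Reachable a k ∧ (0 : ℝ) < w s(k, y) ∧
      (openGraph (↑x.1 : Set (Sym2 V))).Reachable b y ∧
      (openGraph (↑(splice (revealedAt (Finset.univ : Finset (Sym2 V)) (∅ : Finset V) a x.1) x.1 x.2) :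
        Set (Sym2 V))).Reachable c y) ∧
    (∃ y k : V, (openGraph (↑x.1 : Set (Sym2 V))).Reachable a k ∧ (0 : ℝ) < w s(k, y) ∧
      (openGraph (↑x.1 : Set (Sym2 V))).Reachable c y ∧
      (openGraph (↑(splice (revealedAt (Finset.univ : Finset (Sym2 V)) (∅ : Finset V) a x.1) x.1 x.2) :
        Set (Sym2 V))).Reachable b y)} with hBad
  set CW : Set (Finset (Sym2 V) × Finset (Sym2 V)) := {x | ∃ I J : Finset (Sym2 V), Disjoint I x.1 ∧ Iᶜ ∈ A ∧
    Disjoint J (splice (revealedAt (Finset.univ : Finset (Sym2 V)) (∅ : Finset V) a x.1) x.1 x.2) ∧ Jᶜ ∈ A ∧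
    ∀ i ∈ I, i ∈ J → i ∉ revealedAt (Finset.univ : Finset (Sym2 V)) (∅ : Finset V) a x.1} with hCW
  rw [setIntegral_sepOff_sq_eq_Pr2W]
  -- the pairs of `E` without a double clash lie in the closed-witness disjoint occurrence of `A, A`
  have hsub : ∀ x : Finset (Sym2 V) × Finset (Sym2 V), x ∈ E \ Bad → x ∈ CW := by
    rintro ⟨K₁, K₂⟩ ⟨⟨h1, h3⟩, hgood⟩
    have hab : ¬ (openGraph (↑K₁ : Set (Sym2 V))).Reachable a b := h1.1.1
    have hac : ¬ (openGraph (↑K₁ : Set (Sym2 V))).Reachable a c := h1.1.2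
    have hbc : ¬ (openGraph (↑K₁ : Set (Sym2 V))).Reachable b c := h1.2
    have hbc₃ : ¬ (openGraph (↑(splice (revealedAt (Finset.univ : Finset (Sym2 V)) (∅ : Finset V) a K₁) K₁ K₂) :
        Set (Sym2 V))).Reachable b c := h3.2
    show ∃ I J : Finset (Sym2 V), Disjoint I K₁ ∧ Iᶜ ∈ A ∧
        Disjoint J (splice (revealedAt (Finset.univ : Finset (Sym2 V)) (∅ : Finset V) a K₁) K₁ K₂) ∧ Jᶜ ∈ A ∧
        ∀ i ∈ I, i ∈ J → i ∉ revealedAt (Finset.univ : Finset (Sym2 V)) (∅ : Finset V) a K₁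
    by_cases hcl : ∃ y k : V, (openGraph (↑K₁ : Set (Sym2 V))).Reachable a k ∧ (0 : ℝ) < w s(k, y) ∧
        (openGraph (↑K₁ : Set (Sym2 V))).Reachable b y ∧
        (openGraph (↑(splice (revealedAt (Finset.univ : Finset (Sym2 V)) (∅ : Finset V) a K₁) K₁ K₂) :
          Set (Sym2 V))).Reachable c y
    · -- the first pair clashes, so the second does not: witnesses `∂⁺C_c(C₁)`, `∂⁺C_b(C₃)`
      have hno : ¬ ∃ y k : V, (openGraph (↑K₁ : Set (Sym2 V))).Reachable a k ∧ (0 : ℝ) < w s(k, y) ∧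
          (openGraph (↑K₁ : Set (Sym2 V))).Reachable c y ∧
          (openGraph (↑(splice (revealedAt (Finset.univ : Finset (Sym2 V)) (∅ : Finset V) a K₁) K₁ K₂) :
            Set (Sym2 V))).Reachable b y := fun h2 => hgood ⟨hcl, h2⟩
      obtain ⟨I, J, hI, hIA, hJ, hJA, hIJ⟩ := exists_closedWitness_of_noClash w hP a c b K₁ K₂ hac
        (fun h => hbc h.symm) (fun h => hbc₃ h.symm) hab hno
      exact ⟨I, J, hI, fun h => hIA h.symm, hJ, fun h => hJA h.symm, hIJ⟩
    · exact exists_closedWitness_of_noClash w hP a b c K₁ K₂ hab hbc hbc₃ hac hcl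
  -- the closed-witness decision-tree vdBK inequality for the exploration tree of `C_a`
  have key := ClosedBK.Pr2W_closedWitness_le hp0 hp1
    (ttree (Finset.univ : Finset (Sym2 V)) (∅ : Finset V) ((Finset.univ : Finset (Sym2 V)).card + 1)
      (TargetExploration.init a)) (isLowerSet_posSep P b c) (isLowerSet_posSep P b c)
  simp only [← revealedAt_eq_revealed] at key
  have hmono : Pr2W Finset.univ p (E \ Bad) ≤ Pr2W Finset.univ p CW := by
    refine Pr2W_mono Finset.univ hp0 hp1 ?_
    intro x _ _ hx
    have h := hsub x hx
    exact h
  have hU : PrW Finset.univ p A = (prodBernoulli w).real (openConn b c)ᶜ := PrW_posSep_eq w hP b c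
  rw [hU] at key
  rw [Pr2W_eq_inter_add_diff Finset.univ p E Bad, sq, add_comm]
  exact add_le_add (hmono.trans key) le_rfl

/-- **CSQ at `(a; b, c)` when no double clash occurs** (general finite vertex type).  Hypothesis: for every configuration `ω`
with `a ↮ b`, `a ↮ c`, `b ↮ c` and every configuration `η` with `b ↮ c` in `η'` := `η` with the pairs meeting `{a} ∪ V(C_a(ω))` deleted, it is NOT
the case that both some `y` with `b ↔ y` in `ω` and `c ↔ y` in `η'` and some `y'` with `c ↔ y'` in `ω` and `b ↔ y'` in `η'` are joined
to `C_a(ω)` by pairs of positive weight.  Conclusion: `∫_{D_a} u² dμ ≤ μ(b ↮ c)²`.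
[cite: Gladkov2024, Thm. 4.3 (decision-tree vdBK) with Def. 4.2, Lemma 3.1, Example 2.5] -/
theorem setIntegral_sepOff_sq_le_of_noDoubleClash (w : Sym2 V → unitInterval) (a b c : V)
    (hndc : ∀ ω η : Set (Sym2 V), ¬ (openGraph ω).Reachable a b → ¬ (openGraph ω).Reachable a c →
      ¬ (openGraph ω).Reachable b c → ¬ (openGraph (η \ barOf {a} (setCl ω {a}))).Reachable b c →
      ¬ ((∃ y k : V, (openGraph ω).Reachable a k ∧ (0 : ℝ) < w s(k, y) ∧ (openGraph ω).Reachable b y ∧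
            (openGraph (η \ barOf {a} (setCl ω {a}))).Reachable c y) ∧
         (∃ y k : V, (openGraph ω).Reachable a k ∧ (0 : ℝ) < w s(k, y) ∧ (openGraph ω).Reachable c y ∧
            (openGraph (η \ barOf {a} (setCl ω {a}))).Reachable b y))) :
    (∫ ω in (openConn a b)ᶜ ∩ (openConn a c)ᶜ,
        (prodBernoulli w).real {η | ¬ (openGraph (η \ barOf {a} (setCl ω {a}))).Reachable b c} ^ 2 ∂(prodBernoulli w)) ≤
      (prodBernoulli w).real (openConn b c)ᶜ ^ 2 := by
  set p : Sym2 V → ℝ := fun e => (w e : ℝ) with hp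
  have hp0 : ∀ e, 0 ≤ p e := fun e => (w e).2.1
  have hp1 : ∀ e, p e ≤ 1 := fun e => (w e).2.2
  refine (setIntegral_sepOff_sq_le_sq_add_doubleClash w a b c).trans ?_
  -- the hybrid's clusters off `C_a(C₁)` live in `C₂` minus the pairs meeting `C_a(C₁)`, so the double-clash set is empty
  have hcut : ∀ (K₁ K₂ : Finset (Sym2 V)) (t y : V), ¬ (openGraph (↑K₁ : Set (Sym2 V))).Reachable a t →
      ((openGraph (↑(splice (revealedAt (Finset.univ : Finset (Sym2 V)) (∅ : Finset V) a K₁) K₁ K₂) :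
        Set (Sym2 V))).Reachable t y ↔
      (openGraph ((↑K₂ : Set (Sym2 V)) \ barOf {a} (setCl (↑K₁ : Set (Sym2 V)) {a}))).Reachable t y) := by
    intro K₁ K₂ t y hat
    rw [← hybrid_coe_splice, reachable_hybrid_iff_diff_cutSet hat, barOf_setCl_singleton_eq_cutSet]
  have hle : Pr2W Finset.univ p
      ({x : Finset (Sym2 V) × Finset (Sym2 V) |
          (↑x.1 : Set (Sym2 V)) ∈ (openConn a b)ᶜ ∩ (openConn a c)ᶜ ∩ (openConn b c)ᶜ ∧
          (↑(splice (revealedAt (Finset.univ : Finset (Sym2 V)) (∅ : Finset V) a x.1) x.1 x.2) : Set (Sym2 V)) ∈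
            (openConn a b)ᶜ ∩ (openConn a c)ᶜ ∩ (openConn b c)ᶜ} ∩
        {x | (∃ y k : V, (openGraph (↑x.1 : Set (Sym2 V))).Reachable a k ∧ (0 : ℝ) < w s(k, y) ∧
              (openGraph (↑x.1 : Set (Sym2 V))).Reachable b y ∧
              (openGraph (↑(splice (revealedAt (Finset.univ : Finset (Sym2 V)) (∅ : Finset V) a x.1) x.1 x.2) :
                Set (Sym2 V))).Reachable c y) ∧
            (∃ y k : V, (openGraph (↑x.1 : Set (Sym2 V))).Reachable a k ∧ (0 : ℝ) < w s(k, y) ∧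
              (openGraph (↑x.1 : Set (Sym2 V))).Reachable c y ∧
              (openGraph (↑(splice (revealedAt (Finset.univ : Finset (Sym2 V)) (∅ : Finset V) a x.1) x.1 x.2) :
                Set (Sym2 V))).Reachable b y)}) ≤
      Pr2W Finset.univ p (∅ : Set (Finset (Sym2 V) × Finset (Sym2 V))) := by
    refine Pr2W_mono Finset.univ hp0 hp1 ?_
    rintro ⟨K₁, K₂⟩ - - ⟨⟨h1, h3⟩, ⟨y, k, hk, hw, hby, hcy⟩, ⟨y', k', hk', hw', hcy', hby'⟩⟩
    have hab : ¬ (openGraph (↑K₁ : Set (Sym2 V))).Reachable a b := h1.1.1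
    have hac : ¬ (openGraph (↑K₁ : Set (Sym2 V))).Reachable a c := h1.1.2
    have hbc : ¬ (openGraph (↑K₁ : Set (Sym2 V))).Reachable b c := h1.2
    have hbc₃ : ¬ (openGraph ((↑K₂ : Set (Sym2 V)) \ barOf {a} (setCl (↑K₁ : Set (Sym2 V)) {a}))).Reachable b c :=
      fun h => h3.2 ((hcut K₁ K₂ b c hab).2 h)
    exact (hndc ↑K₁ ↑K₂ hab hac hbc hbc₃ ⟨⟨y, k, hk, hw, hby, (hcut K₁ K₂ c y hac).1 hcy⟩,
      ⟨y', k', hk', hw', hcy', (hcut K₁ K₂ b y' hab).1 hby'⟩⟩).elim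
  have h0 : Pr2W Finset.univ p (∅ : Set (Finset (Sym2 V) × Finset (Sym2 V))) = 0 := by simp [Pr2W]
  linarith

/-- **A double clash needs five distinct vertices** (`a, b, c`, a vertex of `C_b(ω) ∩ C_c(η')` and a vertex of `C_c(ω) ∩ C_b(η')`):
on at most four vertices the no-double-clash hypothesis holds automatically. [folklore; counting] -/
theorem noDoubleClash_of_card_le_four (w : Sym2 V → unitInterval) (a b c : V) (hV : Fintype.card V ≤ 4) :
    ∀ ω η : Set (Sym2 V), ¬ (openGraph ω).Reachable a b → ¬ (openGraph ω).Reachable a c →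
      ¬ (openGraph ω).Reachable b c → ¬ (openGraph (η \ barOf {a} (setCl ω {a}))).Reachable b c →
      ¬ ((∃ y k : V, (openGraph ω).Reachable a k ∧ (0 : ℝ) < w s(k, y) ∧ (openGraph ω).Reachable b y ∧
            (openGraph (η \ barOf {a} (setCl ω {a}))).Reachable c y) ∧
         (∃ y k : V, (openGraph ω).Reachable a k ∧ (0 : ℝ) < w s(k, y) ∧ (openGraph ω).Reachable c y ∧
            (openGraph (η \ barOf {a} (setCl ω {a}))).Reachable b y)) := by
  rintro ω η hab hac hbc hbc' ⟨⟨y, -, -, -, hby, hcy⟩, ⟨y', -, -, -, hcy', hby'⟩⟩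
  -- the five vertices `a, b, c, y, y'` are pairwise distinct
  have h1 : a ≠ b := fun h => hab (h ▸ SimpleGraph.Reachable.refl a)
  have h2 : a ≠ c := fun h => hac (h ▸ SimpleGraph.Reachable.refl a)
  have h3 : a ≠ y := fun h => hab (h ▸ hby.symm)
  have h4 : a ≠ y' := fun h => hac (h ▸ hcy'.symm)
  have h5 : b ≠ c := fun h => hbc (h ▸ SimpleGraph.Reachable.refl b)
  have h6 : b ≠ y := fun h => hbc' (h ▸ hcy.symm)
  have h7 : b ≠ y' := fun h => hbc (h ▸ hcy'.symm)
  have h8 : c ≠ y := fun h => hbc (h ▸ hby)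
  have h9 : c ≠ y' := fun h => hbc' (h ▸ hby')
  have h10 : y ≠ y' := fun h => hbc (hby.trans (h ▸ hcy'.symm))
  have hcard : ({a, b, c, y, y'} : Finset V).card = 5 := by
    rw [Finset.card_insert_of_notMem, Finset.card_insert_of_notMem, Finset.card_insert_of_notMem,
      Finset.card_insert_of_notMem, Finset.card_singleton]
    · simpa using h10
    · simp [h8, h9]
    · simp [h5, h6, h7]
    · simp [h1, h2, h3, h4]
  have hle : ({a, b, c, y, y'} : Finset V).card ≤ Fintype.card V := Finset.card_le_univ _
  omega

end General

/-! ### The cluster-square inequality, the rooted split inequality and the triple-split inequality under "no double clash" -/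

/-- **THE CLUSTER-SQUARE INEQUALITY UNDER "NO DOUBLE CLASH"**: if for no configuration `ω ∈ D_a` and fresh configuration `η` off
the pairs meeting `{a} ∪ V(C_a(ω))` BOTH a vertex `y` of `C_b(ω) ∩ C_c(η')` AND a vertex `y'` of `C_c(ω) ∩ C_b(η')` are joined to
`C_a(ω)` by pairs of positive weight, then `T ≤ μ(b ↮ c)²` — the conjecture `Consts.ClusterSquareSplit` at `(a; b, c)`.
[cite: Gladkov2024, Thm. 4.3, Def. 4.2, Lemma 3.1, Example 2.5] -/
theorem clusterSquare_le_sq_of_noDoubleClash {n : ℕ} (w : Sym2 (Fin n) → unitInterval) (a b c : Fin n)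
    (hndc : ∀ ω η : BondConfig (Fin n), ¬ (openGraph ω).Reachable a b → ¬ (openGraph ω).Reachable a c →
      ¬ (openGraph ω).Reachable b c → ¬ (openGraph (η \ barOf {a} (setCl ω {a}))).Reachable b c →
      ¬ ((∃ y k : Fin n, (openGraph ω).Reachable a k ∧ (0 : ℝ) < w s(k, y) ∧ (openGraph ω).Reachable b y ∧
            (openGraph (η \ barOf {a} (setCl ω {a}))).Reachable c y) ∧
         (∃ y k : Fin n, (openGraph ω).Reachable a k ∧ (0 : ℝ) < w s(k, y) ∧ (openGraph ω).Reachable c y ∧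
            (openGraph (η \ barOf {a} (setCl ω {a}))).Reachable b y))) :
    clusterSquare w a b c ≤ (prodBernoulli w).real (openConn b c)ᶜ ^ 2 := by
  unfold clusterSquare sepOffCluster
  exact setIntegral_sepOff_sq_le_of_noDoubleClash w a b c hndc

/-- **The rooted split inequality DUU at `(a; b, c)` under "no double clash"**: `μ(a|b|c)² ≤ μ(a↮b, a↮c) · μ(b↮c)²`
(the body of `Consts.RootedSplit` at this triple). [cite: Gladkov2024, Thm. 5.2 (Cauchy–Schwarz over the cluster of `a`) and Thm. 4.3] -/
theorem sq_real_split_le_of_noDoubleClash {n : ℕ} (w : Sym2 (Fin n) → unitInterval) (a b c : Fin n)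
    (hndc : ∀ ω η : BondConfig (Fin n), ¬ (openGraph ω).Reachable a b → ¬ (openGraph ω).Reachable a c →
      ¬ (openGraph ω).Reachable b c → ¬ (openGraph (η \ barOf {a} (setCl ω {a}))).Reachable b c →
      ¬ ((∃ y k : Fin n, (openGraph ω).Reachable a k ∧ (0 : ℝ) < w s(k, y) ∧ (openGraph ω).Reachable b y ∧
            (openGraph (η \ barOf {a} (setCl ω {a}))).Reachable c y) ∧
         (∃ y k : Fin n, (openGraph ω).Reachable a k ∧ (0 : ℝ) < w s(k, y) ∧ (openGraph ω).Reachable c y ∧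
            (openGraph (η \ barOf {a} (setCl ω {a}))).Reachable b y))) :
    (prodBernoulli w).real ((openConn a b)ᶜ ∩ (openConn a c)ᶜ ∩ (openConn b c)ᶜ) ^ 2 ≤
      (prodBernoulli w).real ((openConn a b)ᶜ ∩ (openConn a c)ᶜ) * (prodBernoulli w).real (openConn b c)ᶜ ^ 2 :=
  (sq_real_split_le_real_mul_clusterSquare w a b c).trans
    (mul_le_mul_of_nonneg_left (clusterSquare_le_sq_of_noDoubleClash w a b c hndc) measureReal_nonneg)

/-- **The triple-split inequality TS at `{a, b, c}` under "no double clash" at the root `a`**: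
`μ(a|b|c)² ≤ μ(a↮b) · μ(a↮c) · μ(b↮c)` (the body of `Consts.TripleSplit` at this triple), from DUU at `a`, `{b↮c} ⊆ {a↮b} ∪ {a↮c}`
and inclusion–exclusion `μ(D_a)·μ({a↮b}∪{a↮c}) ≤ μ(a↮b)·μ(a↮c)`. [cite: Gladkov2024, Thm. 5.2 and Cor. 5.3 (pattern)] -/
theorem tripleSplit_of_noDoubleClash {n : ℕ} (w : Sym2 (Fin n) → unitInterval) (a b c : Fin n)
    (hndc : ∀ ω η : BondConfig (Fin n), ¬ (openGraph ω).Reachable a b → ¬ (openGraph ω).Reachable a c →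
      ¬ (openGraph ω).Reachable b c → ¬ (openGraph (η \ barOf {a} (setCl ω {a}))).Reachable b c →
      ¬ ((∃ y k : Fin n, (openGraph ω).Reachable a k ∧ (0 : ℝ) < w s(k, y) ∧ (openGraph ω).Reachable b y ∧
            (openGraph (η \ barOf {a} (setCl ω {a}))).Reachable c y) ∧
         (∃ y k : Fin n, (openGraph ω).Reachable a k ∧ (0 : ℝ) < w s(k, y) ∧ (openGraph ω).Reachable c y ∧
            (openGraph (η \ barOf {a} (setCl ω {a}))).Reachable b y))) :
    (prodBernoulli w).real ((openConn a b)ᶜ ∩ (openConn a c)ᶜ ∩ (openConn b c)ᶜ) ^ 2 ≤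
      (prodBernoulli w).real (openConn a b)ᶜ * (prodBernoulli w).real (openConn a c)ᶜ *
        (prodBernoulli w).real (openConn b c)ᶜ := by
  set μ := prodBernoulli w with hμ
  have hUV : μ.real (openConn b c)ᶜ ≤ μ.real ((openConn a b)ᶜ ∪ (openConn a c)ᶜ) := by
    refine measureReal_mono (fun ω hω => ?_) (measure_ne_top _ _)
    by_contra hV
    simp only [Set.mem_union, Set.mem_compl_iff, not_or, not_not] at hV
    exact hω (hV.1.symm.trans hV.2)
  have h0 : (0 : ℝ) ≤ μ.real (openConn b c)ᶜ := measureReal_nonneg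
  have hD0 : (0 : ℝ) ≤ μ.real ((openConn a b)ᶜ ∩ (openConn a c)ᶜ) := measureReal_nonneg
  have h2 := real_inter_mul_real_union_le n w (openConn a b)ᶜ (openConn a c)ᶜ
  calc μ.real ((openConn a b)ᶜ ∩ (openConn a c)ᶜ ∩ (openConn b c)ᶜ) ^ 2
      ≤ μ.real ((openConn a b)ᶜ ∩ (openConn a c)ᶜ) * μ.real (openConn b c)ᶜ ^ 2 :=
        sq_real_split_le_of_noDoubleClash w a b c hndc
    _ = μ.real ((openConn a b)ᶜ ∩ (openConn a c)ᶜ) * μ.real (openConn b c)ᶜ * μ.real (openConn b c)ᶜ := by ring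
    _ ≤ μ.real ((openConn a b)ᶜ ∩ (openConn a c)ᶜ) * μ.real ((openConn a b)ᶜ ∪ (openConn a c)ᶜ) *
          μ.real (openConn b c)ᶜ :=
        mul_le_mul_of_nonneg_right (mul_le_mul_of_nonneg_left hUV hD0) h0
    _ ≤ μ.real (openConn a b)ᶜ * μ.real (openConn a c)ᶜ * μ.real (openConn b c)ᶜ := mul_le_mul_of_nonneg_right h2 h0

/-- **CSQ, unconditionally, on at most four vertices**: `T ≤ μ(b↮c)²` for every weighted graph on `Fin n`, `n ≤ 4`
(a double clash needs five vertices). [cite: Gladkov2024, Thm. 4.3; derived here] -/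
theorem clusterSquare_le_sq_of_le_four {n : ℕ} (hn : n ≤ 4) (w : Sym2 (Fin n) → unitInterval) (a b c : Fin n) :
    clusterSquare w a b c ≤ (prodBernoulli w).real (openConn b c)ᶜ ^ 2 :=
  clusterSquare_le_sq_of_noDoubleClash w a b c
    (noDoubleClash_of_card_le_four w a b c (by simpa using hn))

/-- **The triple-split inequality TS, unconditionally, on at most four vertices** (in particular for every weighted `K₄`):
`μ(a|b|c)² ≤ μ(a↮b)·μ(a↮c)·μ(b↮c)`. [cite: Gladkov2024, Thm. 4.3 and Thm. 5.2 (pattern); derived here] -/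
theorem tripleSplit_of_le_four {n : ℕ} (hn : n ≤ 4) (w : Sym2 (Fin n) → unitInterval) (a b c : Fin n) :
    (prodBernoulli w).real ((openConn a b)ᶜ ∩ (openConn a c)ᶜ ∩ (openConn b c)ᶜ) ^ 2 ≤
      (prodBernoulli w).real (openConn a b)ᶜ * (prodBernoulli w).real (openConn a c)ᶜ *
        (prodBernoulli w).real (openConn b c)ᶜ :=
  tripleSplit_of_noDoubleClash w a b c (noDoubleClash_of_card_le_four w a b c (by simpa using hn))

end Consts

end Summit.CriticalPhenomena.PercolationContinuityZ3.Theorems
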